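import Literature.NumberTheory.LFunctions.DesignDataOfTypes
import Literature.NumberTheory.LFunctions.RosserSchoenfeldMertensFirstConstantCorollaries

/-!
# Existence of the type limits ([CV] Lemma 3.5) and the bound-only design interface (W-MAG §§3–5)

In the 2001 magnification programme (archive `2001`, `rh-w-magnification/free/y1` = W-MAG, and
`rh-w-composite-vanishing/free/y1` = [CV]) the analytic machine delivers, for every finitely supported
resonator `α`, the **type inequality** `lim_x ∑_{n ≤ x} ((c−Λ)(n)/n)·Re Φ_α(n) ≤ D·Φ_α(1)` for the gcd form
`Φ_α(n) = ∑_{ℓ,ℓ' ≤ L} α_ℓ conj(α_ℓ') gcd(nℓ',ℓ)/√(ℓℓ')` (`GcdForm.gcdForm`).  The *existence* of the limit is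
not analytic: it is [CV] Lemma 3.5 ("every gcd-class sum converges"), a consequence of

* local summability `∑_{p ∣ n} c(n)/n < ∞` for every prime `p` (the conclusion of the crux stub
  `stub_combLocal`), and
* the convergence of `∑_{n ≤ x} (c(n) − Λ(n))/n` (Mertens for `c`, the conclusion (ii) of the crux stub
  `stub_fakeMertens`, together with `∑_{n ≤ x} Λ(n)/n − log x → −γ`,
  `Literature.NumberTheory.LFunctions.tendsto_sum_vonMangoldt_div_sub_log`),

because `Φ_α(n) = Φ_α(1)` unless a prime `p ≤ L` divides `n` (`gcdForm_eq_gcdForm_one`), `Φ_α` is bounded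
(`norm_gcdForm_le`), and `∑_{p ∣ n} |(c−Λ)(n)|/n < ∞` for each prime `p` (`summable_abs_z_of_dvd`).  This file
PROVES the existence of all type limits (`tendsto_typeSum`, with the value
`Φ_α(1)·C₁ + ∑' (c−Λ)(n)/n · (Re Φ_α(n) − Re Φ_α(1))`), and restates the design interface
`TypeDesign.designData_of_typeIneq` of `DesignDataOfTypes` with the type hypothesis weakened to a **bound on
the limit only** (`designData_of_typeBound`, `designData_of_mertens_typeBound`: hypotheses verbatim the
conclusions of the crux stubs `stub_fakeMertens` (ii), `stub_combLocal`, and the inequality half of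
`stub_combType` of `Summits/RiemannHypothesis/RiemannHypothesis/Cruxes/ConeMagnification/Lines/Sketch.lean`).

It also PROVES the generic "`M → ∞`" step used there (logarithmic Riesz means of a convergent series):
a summation method with nonnegative, nonincreasing, finitely supported weights tending pointwise to `1` is
regular (`tendsto_sum_mul_weight_of_tendsto`, Abel summation; Hardy, *Divergent Series*, Thm. 2 is the
general Toeplitz criterion — here only the monotone special case is needed and proved).

Sources: archive `2001` — `rh-w-composite-vanishing/free/y1` Lemma 3.5, `rh-w-magnification/free/y1` §§3–5
(statement level: stockroom `Rh_WMagnificationY1_MagDeficit.lean`); unpublished internal preprints;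
everything here is PROVED (`[folklore]` tags).
-/

noncomputable section

open scoped BigOperators ComplexConjugate Classical
open Filter Finset ArithmeticFunction
open _root_.Topology

namespace Literature.NumberTheory.LFunctions

namespace TypeDesign

open GcdForm

/-! ### The gcd form is constant off the multiples of the primes `≤ L`, and bounded -/

/-- If no prime `p ≤ L` divides `n`, then `n` is coprime to every `ℓ ∈ [1, L]`. [folklore] -/
theorem coprime_of_forall_prime_le {L n : ℕ} (hn : ∀ p : ℕ, p.Prime → p ≤ L → ¬ p ∣ n) {ℓ : ℕ}
    (hℓ : ℓ ∈ Finset.Icc 1 L) : Nat.Coprime n ℓ := by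
  by_contra h
  obtain ⟨p, hp, hpn, hpℓ⟩ := Nat.Prime.not_coprime_iff_dvd.mp h
  have hℓ' := Finset.mem_Icc.mp hℓ
  exact hn p hp ((Nat.le_of_dvd (by omega) hpℓ).trans hℓ'.2) hpn

/-- [CV] Lemma 3.5, the key observation: the gcd form `Φ_α(n)` equals `Φ_α(1)` unless a prime `p ≤ L`
divides `n` (`gcd(nℓ', ℓ) = gcd(ℓ', ℓ)` for `n` coprime to `ℓ`). [folklore] -/
theorem gcdForm_eq_gcdForm_one (α : ℕ → ℂ) {L n : ℕ} (hn : ∀ p : ℕ, p.Prime → p ≤ L → ¬ p ∣ n) :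
    gcdForm α L n = gcdForm α L 1 := by
  unfold gcdForm
  refine Finset.sum_congr rfl fun ℓ hℓ => Finset.sum_congr rfl fun ℓ' _ => ?_
  rw [(coprime_of_forall_prime_le hn hℓ).gcd_mul_left_cancel, one_mul]

/-- The gcd form is bounded uniformly in `n`: `|Φ_α(n)| ≤ ∑_{ℓ,ℓ'} |α_ℓ||α_ℓ'| ℓ`. [folklore] -/
theorem norm_gcdForm_le (α : ℕ → ℂ) (L n : ℕ) :
    ‖gcdForm α L n‖ ≤ ∑ ℓ ∈ Finset.Icc 1 L, ∑ ℓ' ∈ Finset.Icc 1 L, ‖α ℓ‖ * ‖α ℓ'‖ * ℓ := by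
  unfold gcdForm
  refine (norm_sum_le _ _).trans (Finset.sum_le_sum fun ℓ hℓ => (norm_sum_le _ _).trans
    (Finset.sum_le_sum fun ℓ' hℓ' => ?_))
  have hℓ1 : 1 ≤ ℓ := (Finset.mem_Icc.mp hℓ).1
  have hℓ'1 : 1 ≤ ℓ' := (Finset.mem_Icc.mp hℓ').1
  rw [norm_div, norm_mul, norm_mul, Complex.norm_conj, Complex.norm_real, Complex.norm_real,
    Real.norm_of_nonneg (Nat.cast_nonneg _), Real.norm_of_nonneg (Real.sqrt_nonneg _)]
  have hg : ((Nat.gcd (n * ℓ') ℓ : ℕ) : ℝ) ≤ ℓ := by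
    exact_mod_cast Nat.gcd_le_right (m := n * ℓ') (n := ℓ) (by omega)
  have hs : 1 ≤ Real.sqrt ((ℓ : ℝ) * ℓ') := by
    rw [Real.one_le_sqrt]
    have h1 : (1 : ℝ) ≤ ℓ := by exact_mod_cast hℓ1
    have h2 : (1 : ℝ) ≤ ℓ' := by exact_mod_cast hℓ'1
    nlinarith
  calc ‖α ℓ‖ * ‖α ℓ'‖ * ((Nat.gcd (n * ℓ') ℓ : ℕ) : ℝ) / Real.sqrt ((ℓ : ℝ) * ℓ')
      ≤ ‖α ℓ‖ * ‖α ℓ'‖ * ((Nat.gcd (n * ℓ') ℓ : ℕ) : ℝ) := div_le_self (by positivity) hs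
    _ ≤ ‖α ℓ‖ * ‖α ℓ'‖ * ℓ := by gcongr

/-! ### Local absolute summability of `z = (c − Λ)/n` from local summability of `c` -/

/-- `∑_{p ∣ n} Λ(n)/n = ∑_{k ≥ 1} (log p)/p^k < ∞`. [folklore] -/
theorem summable_vonMangoldt_div_of_dvd {p : ℕ} (hp : p.Prime) :
    Summable fun n : ℕ => if p ∣ n then (Λ n : ℝ) / n else 0 := by
  have hinj : Function.Injective fun k : ℕ => p ^ (k + 1) := by
    intro a b hab
    have := Nat.pow_right_injective hp.two_le hab
    omega
  have hzero : ∀ n ∉ Set.range (fun k : ℕ => p ^ (k + 1)),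
      (if p ∣ n then (Λ n : ℝ) / n else 0) = 0 := by
    intro n hn
    split_ifs with hpn
    · have hΛ : Λ n = 0 := by
        by_contra h
        obtain ⟨q, k, hq, hk, rfl⟩ := (isPrimePow_nat_iff _).mp (vonMangoldt_ne_zero_iff.mp h)
        have hpq := (Nat.prime_dvd_prime_iff_eq hp hq).mp (hp.dvd_of_dvd_pow hpn)
        subst hpq
        exact hn ⟨k - 1, by simp only [Nat.sub_add_cancel hk]⟩
      rw [hΛ, zero_div]
    · rfl
  refine (hinj.summable_iff hzero).mp ?_
  have hp1 : (1 : ℝ) < p := by exact_mod_cast hp.one_lt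
  have hgeom : Summable fun k : ℕ => ((p : ℝ)⁻¹) ^ k :=
    summable_geometric_of_lt_one (by positivity) (inv_lt_one_of_one_lt₀ hp1)
  refine (hgeom.mul_left (Real.log p / p)).congr fun k => ?_
  simp only [Function.comp_apply]
  rw [if_pos (dvd_pow_self p (Nat.succ_ne_zero k)), vonMangoldt_apply_pow (Nat.succ_ne_zero k),
    vonMangoldt_apply_prime hp]
  have hp0 : (p : ℝ) ≠ 0 := by positivity
  rw [inv_pow, Nat.cast_pow, pow_succ]
  field_simp

/-- [CV] Lemma 2.3(ii)/3.5 input: `∑_{p ∣ n} |(c−Λ)(n)|/n < ∞` from local summability of `c ≥ 0`.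
[folklore] -/
theorem summable_abs_z_of_dvd {c : ℕ → ℝ} (hc : ∀ n, 0 ≤ c n) {p : ℕ} (hp : p.Prime)
    (hloc : Summable (fun n : ℕ => if p ∣ n then c n / n else 0)) :
    Summable fun n : ℕ => if p ∣ n then |z c n| else 0 := by
  refine Summable.of_nonneg_of_le (fun n => ?_) (fun n => ?_)
    (hloc.add (summable_vonMangoldt_div_of_dvd hp))
  · split_ifs
    · exact abs_nonneg _
    · exact le_rfl
  · split_ifs with h
    · unfold z
      rw [sub_div]
      refine (abs_sub _ _).trans (le_of_eq ?_)
      rw [abs_of_nonneg (div_nonneg (hc n) (Nat.cast_nonneg n)),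
        abs_of_nonneg (div_nonneg vonMangoldt_nonneg (Nat.cast_nonneg n))]
    · simp

/-- `∑ { |(c−Λ)(n)|/n : some prime p ≤ L divides n } < ∞`. [folklore] -/
theorem summable_abs_z_smallPrimes {c : ℕ → ℝ} (hc : ∀ n, 0 ≤ c n)
    (hloc : ∀ p : ℕ, p.Prime → Summable (fun n : ℕ => if p ∣ n then c n / n else 0)) (L : ℕ) :
    Summable fun n : ℕ => if ∃ p : ℕ, p.Prime ∧ p ≤ L ∧ p ∣ n then |z c n| else 0 := by
  set P : Finset ℕ := (Finset.range (L + 1)).filter Nat.Prime with hP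
  have hsum : Summable fun n : ℕ => ∑ p ∈ P, if p ∣ n then |z c n| else 0 :=
    summable_sum fun p hp => summable_abs_z_of_dvd hc (Finset.mem_filter.mp hp).2
      (hloc p (Finset.mem_filter.mp hp).2)
  refine Summable.of_nonneg_of_le (fun n => ?_) (fun n => ?_) hsum
  · split_ifs
    · exact abs_nonneg _
    · exact le_rfl
  · split_ifs with hex
    · obtain ⟨p, hp, hpL, hpn⟩ := hex
      have hpP : p ∈ P := Finset.mem_filter.mpr ⟨Finset.mem_range.mpr (by omega), hp⟩
      calc |z c n| = if p ∣ n then |z c n| else 0 := by rw [if_pos hpn]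
        _ ≤ ∑ q ∈ P, if q ∣ n then |z c n| else 0 :=
          Finset.single_le_sum (f := fun q => if q ∣ n then |z c n| else 0)
            (fun q _ => by
              split_ifs
              · exact abs_nonneg _
              · exact le_rfl) hpP
    · exact Finset.sum_nonneg fun q _ => by
        split_ifs
        · exact abs_nonneg _
        · exact le_rfl

/-- [CV] Lemma 3.5 (absolute part): `∑_n ((c−Λ)(n)/n)·(Re Φ_α(n) − Re Φ_α(1))` converges absolutely.
[folklore] -/
theorem summable_z_mul_gcdForm_sub {c : ℕ → ℝ} (hc : ∀ n, 0 ≤ c n)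
    (hloc : ∀ p : ℕ, p.Prime → Summable (fun n : ℕ => if p ∣ n then c n / n else 0))
    (α : ℕ → ℂ) (L : ℕ) :
    Summable fun n : ℕ => z c n * ((gcdForm α L n).re - (gcdForm α L 1).re) := by
  set B : ℝ := ∑ ℓ ∈ Finset.Icc 1 L, ∑ ℓ' ∈ Finset.Icc 1 L, ‖α ℓ‖ * ‖α ℓ'‖ * ℓ with hB
  refine (Summable.of_nonneg_of_le (fun n => abs_nonneg _) (fun n => ?_)
    ((summable_abs_z_smallPrimes hc hloc L).mul_right (2 * B))).of_abs
  rw [abs_mul]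
  by_cases hex : ∃ p : ℕ, p.Prime ∧ p ≤ L ∧ p ∣ n
  · rw [if_pos hex]
    refine mul_le_mul_of_nonneg_left ?_ (abs_nonneg _)
    calc |(gcdForm α L n).re - (gcdForm α L 1).re|
        ≤ |(gcdForm α L n).re| + |(gcdForm α L 1).re| := abs_sub _ _
      _ ≤ ‖gcdForm α L n‖ + ‖gcdForm α L 1‖ :=
          add_le_add (Complex.abs_re_le_norm _) (Complex.abs_re_le_norm _)
      _ ≤ B + B := add_le_add (norm_gcdForm_le α L n) (norm_gcdForm_le α L 1)
      _ = 2 * B := by ring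
  · have hn : ∀ p : ℕ, p.Prime → p ≤ L → ¬ p ∣ n := fun p hp hpL hpn => hex ⟨p, hp, hpL, hpn⟩
    rw [if_neg hex, gcdForm_eq_gcdForm_one α hn, sub_self, abs_zero, mul_zero, zero_mul]

/-! ### Partial sums over `[1, ⌊x⌋]` -/

/-- The partial sums `∑_{1 ≤ n ≤ x} f(n)` of a summable `f` with `f 0 = 0` tend to `∑' f`. [folklore] -/
theorem tendsto_sum_Icc_floor_of_summable {f : ℕ → ℝ} (hf0 : f 0 = 0) (hf : Summable f) :
    Tendsto (fun x : ℝ => ∑ n ∈ Finset.Icc 1 ⌊x⌋₊, f n) atTop (𝓝 (∑' n, f n)) := by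
  have h1 : Tendsto (fun N : ℕ => ∑ n ∈ Finset.range (N + 1), f n) atTop (𝓝 (∑' n, f n)) :=
    (tendsto_add_atTop_iff_nat 1).2 hf.hasSum.tendsto_sum_nat
  refine (h1.comp tendsto_nat_floor_atTop).congr fun x => ?_
  simp only [Function.comp_apply]
  rw [Finset.range_eq_Ico, Finset.sum_eq_sum_Ico_succ_bot (Nat.succ_pos _), hf0, zero_add]
  rfl

/-- `∑_{n ≤ x} (c(n) − Λ(n))/n` converges, from Mertens for `c` (conclusion (ii) of the crux stub
`stub_fakeMertens`, verbatim) and `∑_{n ≤ x} Λ(n)/n − log x → −γ`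
(`tendsto_sum_vonMangoldt_div_sub_log`). [folklore] -/
theorem tendsto_sum_sub_vonMangoldt_div_of_mertens {c : ℕ → ℝ} {C : ℝ}
    (hM : Tendsto (fun x : ℝ => (∑ n ∈ Finset.Icc 1 ⌊x⌋₊, c n / n) - Real.log x) atTop (𝓝 C)) :
    Tendsto (fun x : ℝ => ∑ n ∈ Finset.Icc 1 ⌊x⌋₊, (c n - Λ n) / n) atTop
      (𝓝 (C + Real.eulerMascheroniConstant)) := by
  have h := hM.sub tendsto_sum_vonMangoldt_div_sub_log
  rw [show C - -Real.eulerMascheroniConstant = C + Real.eulerMascheroniConstant by ring] at h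
  refine h.congr fun x => ?_
  have hI : Finset.Icc 1 ⌊x⌋₊ = Finset.Ioc 0 ⌊x⌋₊ := Finset.Icc_add_one_left_eq_Ioc 0 ⌊x⌋₊
  rw [← hI]
  simp only [sub_div, Finset.sum_sub_distrib]
  ring

/-! ### [CV] Lemma 3.5: the type limits exist -/

/-- **[CV] Lemma 3.5 (existence of the type limits).**  For `c ≥ 0` with local summability
`∑_{p ∣ n} c(n)/n < ∞` (every prime `p`) and `∑_{n ≤ x} (c−Λ)(n)/n → C₁`, and for every resonator
`α` and level `L`, the type sums converge:
`∑_{n ≤ x} ((c−Λ)(n)/n)·Re Φ_α(n) → Re Φ_α(1)·C₁ + ∑' ((c−Λ)(n)/n)(Re Φ_α(n) − Re Φ_α(1))`. [folklore] -/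
theorem tendsto_typeSum {c : ℕ → ℝ} (hc : ∀ n, 0 ≤ c n)
    (hloc : ∀ p : ℕ, p.Prime → Summable (fun n : ℕ => if p ∣ n then c n / n else 0))
    {C₁ : ℝ} (hC₁ : Tendsto (fun x : ℝ => ∑ n ∈ Finset.Icc 1 ⌊x⌋₊,
      (c n - ArithmeticFunction.vonMangoldt n) / n) atTop (𝓝 C₁))
    (α : ℕ → ℂ) (L : ℕ) :
    Tendsto (fun x : ℝ => ∑ n ∈ Finset.Icc 1 ⌊x⌋₊,
        (c n - ArithmeticFunction.vonMangoldt n) / n * (gcdForm α L n).re) atTop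
      (𝓝 ((gcdForm α L 1).re * C₁ +
        ∑' n : ℕ, (c n - ArithmeticFunction.vonMangoldt n) / n *
          ((gcdForm α L n).re - (gcdForm α L 1).re))) := by
  have h2 := tendsto_sum_Icc_floor_of_summable
    (f := fun n => z c n * ((gcdForm α L n).re - (gcdForm α L 1).re))
    (by simp [z]) (summable_z_mul_gcdForm_sub hc hloc α L)
  have h1 := hC₁.const_mul ((gcdForm α L 1).re)
  refine (h1.add h2).congr fun x => ?_
  simp only [z]
  rw [Finset.mul_sum, ← Finset.sum_add_distrib]
  refine Finset.sum_congr rfl fun n _ => ?_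
  ring

/-- The type limit is unique: any limit `T` of the type sums is the value of `tendsto_typeSum`.
[folklore] -/
theorem typeLimit_eq {c : ℕ → ℝ} (hc : ∀ n, 0 ≤ c n)
    (hloc : ∀ p : ℕ, p.Prime → Summable (fun n : ℕ => if p ∣ n then c n / n else 0))
    {C₁ : ℝ} (hC₁ : Tendsto (fun x : ℝ => ∑ n ∈ Finset.Icc 1 ⌊x⌋₊,
      (c n - ArithmeticFunction.vonMangoldt n) / n) atTop (𝓝 C₁))
    (α : ℕ → ℂ) (L : ℕ) {T : ℝ}
    (hT : Tendsto (fun x : ℝ => ∑ n ∈ Finset.Icc 1 ⌊x⌋₊,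
        (c n - ArithmeticFunction.vonMangoldt n) / n * (gcdForm α L n).re) atTop (𝓝 T)) :
    T = (gcdForm α L 1).re * C₁ +
        ∑' n : ℕ, (c n - ArithmeticFunction.vonMangoldt n) / n *
          ((gcdForm α L n).re - (gcdForm α L 1).re) :=
  tendsto_nhds_unique hT (tendsto_typeSum hc hloc hC₁ α L)

/-! ### The design interface with bound-only type hypotheses -/

/-- **Design data from local summability, `C₁`, and BOUNDS on the type limits.**  As
`TypeDesign.designData_of_typeIneq`, but the type hypothesis only asks that *every* limit `T` of the type
sums of a finitely supported resonator satisfies `T ≤ D·Re Φ_α(1)`; the existence of the limit is supplied by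
`tendsto_typeSum` ([CV] Lemma 3.5).  Conclusion verbatim the design data AX-A ∧ AX-B ∧ AX-C(`D`) of the
crux stub `stub_designOfTypes` (`D = 1/2` there). [folklore] -/
theorem designData_of_typeBound (D : ℝ) (c : ℕ → ℝ) (hc : ∀ n, 0 ≤ c n) (hc1 : c 1 = 0)
    (hloc : ∀ p : ℕ, p.Prime → Summable (fun n : ℕ => if p ∣ n then c n / n else 0))
    {C₁ : ℝ} (hC₁ : Tendsto (fun x : ℝ => ∑ n ∈ Finset.Icc 1 ⌊x⌋₊,
      (c n - ArithmeticFunction.vonMangoldt n) / n) atTop (𝓝 C₁))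
    (hT : ∀ α : ℕ → ℂ, ∀ L : ℕ, (∀ m, L < m → α m = 0) → ∀ T : ℝ,
      Filter.Tendsto (fun x : ℝ => ∑ n ∈ Finset.Icc 1 ⌊x⌋₊,
          (c n - ArithmeticFunction.vonMangoldt n) / n * (gcdForm α L n).re) Filter.atTop (nhds T) →
        T ≤ D * (gcdForm α L 1).re) :
    Summable (fun n : ℕ => |c n - ArithmeticFunction.vonMangoldt n| / (n : ℝ)) ∧
    Summable (fun n : ℕ => if 2 ≤ n ∧ ¬ IsPrimePow n then
      c n / (n : ℝ) * (∑ q ∈ n.primeFactors, ∑ q' ∈ n.primeFactors.filter (fun q' => q < q'),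
        ((Real.sqrt q - 1) / 2) * ((Real.sqrt q' - 1) / 2)) else 0) ∧
    (∀ S : Finset ℕ, (∀ p ∈ S, p.Prime) → ∀ a : ℕ → ℝ, (∀ p ∈ S, 0 ≤ a p ∧ a p ≤ 1) → ∀ φ : ℝ,
      (∑' n : ℕ, (c n - ArithmeticFunction.vonMangoldt n) / (n : ℝ) *
        (if ∀ p ∈ S, ¬ (p ^ 2 ∣ n) then
          Real.sqrt (∏ p ∈ S.filter (· ∣ n), (p : ℝ)) * (∏ p ∈ S.filter (· ∣ n), a p) *
            (1 / 2) ^ (S.filter (· ∣ n)).card * Real.cos (((S.filter (· ∣ n)).card : ℝ) * φ)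
        else 0)) ≤ D) :=
  designData_of_typeIneq D c hc hc1 hloc fun α L hα =>
    ⟨_, tendsto_typeSum hc hloc hC₁ α L, hT α L hα _ (tendsto_typeSum hc hloc hC₁ α L)⟩

/-- **Design data from Mertens, local summability, and BOUNDS on the type limits** — the interface of the
crux line with the arithmetic halves supplied: hypotheses are (verbatim) conclusion (ii) of `stub_fakeMertens`
(Mertens for `c`), the conclusion of `stub_combLocal` (local summability), and the *inequality half* of the
conclusion of `stub_combType` (for every limit of the type sums); conclusion (verbatim) the design data of
`stub_designOfTypes` with constant `D` (`= 1/2` there).  W-MAG §§3–5 / [CV] §§3–4. [folklore] -/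
theorem designData_of_mertens_typeBound (D : ℝ) (c : ℕ → ℝ) (hc : ∀ n, 0 ≤ c n) (hc1 : c 1 = 0)
    (hM : ∃ C : ℝ, Filter.Tendsto (fun x : ℝ => (∑ n ∈ Finset.Icc 1 ⌊x⌋₊, c n / n) - Real.log x)
      Filter.atTop (nhds C))
    (hloc : ∀ p : ℕ, p.Prime → Summable (fun n : ℕ => if p ∣ n then c n / n else 0))
    (hT : ∀ α : ℕ → ℂ, ∀ L : ℕ, (∀ m, L < m → α m = 0) → ∀ T : ℝ,
      Filter.Tendsto (fun x : ℝ => ∑ n ∈ Finset.Icc 1 ⌊x⌋₊,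
          (c n - ArithmeticFunction.vonMangoldt n) / n * (gcdForm α L n).re) Filter.atTop (nhds T) →
        T ≤ D * (gcdForm α L 1).re) :
    Summable (fun n : ℕ => |c n - ArithmeticFunction.vonMangoldt n| / (n : ℝ)) ∧
    Summable (fun n : ℕ => if 2 ≤ n ∧ ¬ IsPrimePow n then
      c n / (n : ℝ) * (∑ q ∈ n.primeFactors, ∑ q' ∈ n.primeFactors.filter (fun q' => q < q'),
        ((Real.sqrt q - 1) / 2) * ((Real.sqrt q' - 1) / 2)) else 0) ∧
    (∀ S : Finset ℕ, (∀ p ∈ S, p.Prime) → ∀ a : ℕ → ℝ, (∀ p ∈ S, 0 ≤ a p ∧ a p ≤ 1) → ∀ φ : ℝ,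
      (∑' n : ℕ, (c n - ArithmeticFunction.vonMangoldt n) / (n : ℝ) *
        (if ∀ p ∈ S, ¬ (p ^ 2 ∣ n) then
          Real.sqrt (∏ p ∈ S.filter (· ∣ n), (p : ℝ)) * (∏ p ∈ S.filter (· ∣ n), a p) *
            (1 / 2) ^ (S.filter (· ∣ n)).card * Real.cos (((S.filter (· ∣ n)).card : ℝ) * φ)
        else 0)) ≤ D) := by
  obtain ⟨C, hC⟩ := hM
  exact designData_of_typeBound D c hc hc1 hloc (tendsto_sum_sub_vonMangoldt_div_of_mertens hC) hT

/-! ### Regularity of monotone summation methods (the "`M → ∞`" step) -/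

/-- Abel summation: for weights `w`, partial sums `s(N) = ∑_{n<N} a(n)` and any `T`,
`∑_{n<N} a(n) w(n) = s(N) w(N) + T (w(0) − w(N)) + ∑_{n<N} (w(n) − w(n+1)) (s(n+1) − T)`. [folklore] -/
theorem sum_mul_weight_eq_abel (a w : ℕ → ℝ) (T : ℝ) (N : ℕ) :
    ∑ n ∈ Finset.range N, a n * w n =
      (∑ n ∈ Finset.range N, a n) * w N + T * (w 0 - w N) +
        ∑ n ∈ Finset.range N, (w n - w (n + 1)) * ((∑ k ∈ Finset.range (n + 1), a k) - T) := by
  induction N with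
  | zero => simp
  | succ N ih =>
    rw [Finset.sum_range_succ (fun n => a n * w n), ih, Finset.sum_range_succ (fun n => a n) N,
      Finset.sum_range_succ (fun n => (w n - w (n + 1)) * ((∑ k ∈ Finset.range (n + 1), a k) - T)) N,
      Finset.sum_range_succ (fun n => a n) N]
    ring

/-- Telescoping over `[m, n)`: `∑_{m ≤ k < n} (f(k) − f(k+1)) = f(m) − f(n)`. [folklore] -/
theorem sum_Ico_sub_succ (f : ℕ → ℝ) {m n : ℕ} (h : m ≤ n) :
    ∑ k ∈ Finset.Ico m n, (f k - f (k + 1)) = f m - f n := by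
  induction n, h using Nat.le_induction with
  | base => simp
  | succ n hmn ih => rw [Finset.sum_Ico_succ_top hmn, ih]; ring

/-- **Regularity of monotone summation methods** (the "`M → ∞`" step of the type inequality:
logarithmic Riesz means of a *convergent* series converge to its sum).  If `∑_{n<N} a(n) → T` and the
weights `w i : ℕ → ℝ` are (eventually along a filter `l`) nonnegative, nonincreasing and vanish from `N i`
on, and tend to `1` pointwise along `l`, then `∑_{n < N i} a(n) w_i(n) → T` along `l`.  (Abel summation;
the monotone special case of the Toeplitz–Schur regularity criterion.) [folklore] -/
theorem tendsto_sum_mul_weight_of_tendsto {a : ℕ → ℝ} {T : ℝ}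
    (ha : Tendsto (fun N : ℕ => ∑ n ∈ Finset.range N, a n) atTop (𝓝 T))
    {ι : Type*} {l : Filter ι} (w : ι → ℕ → ℝ) (N : ι → ℕ)
    (hw_anti : ∀ᶠ i in l, Antitone (w i)) (hw_nonneg : ∀ᶠ i in l, ∀ n, 0 ≤ w i n)
    (hw_zero : ∀ᶠ i in l, ∀ n, N i ≤ n → w i n = 0)
    (hw_one : ∀ n, Tendsto (fun i => w i n) l (𝓝 1)) :
    Tendsto (fun i => ∑ n ∈ Finset.range (N i), a n * w i n) l (𝓝 T) := by
  set s : ℕ → ℝ := fun N => ∑ n ∈ Finset.range N, a n with hs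
  set t : ι → ℕ → ℝ := fun i n => (w i n - w i (n + 1)) * (s (n + 1) - T) with ht
  -- Abel summation with `w i (N i) = 0`
  have habel : ∀ᶠ i in l, T * w i 0 + ∑ n ∈ Finset.range (N i), t i n =
      ∑ n ∈ Finset.range (N i), a n * w i n := by
    filter_upwards [hw_zero] with i hz
    rw [sum_mul_weight_eq_abel a (w i) T (N i), hz (N i) le_rfl]
    simp only [ht, hs]
    ring
  have h0 : Tendsto (fun i => T * w i 0) l (𝓝 T) := by
    simpa using (hw_one 0).const_mul T
  -- the error terms tend to `0`
  have hmain : Tendsto (fun i => ∑ n ∈ Finset.range (N i), t i n) l (𝓝 0) := by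
    rw [Metric.tendsto_nhds]
    intro ε hε
    obtain ⟨K, hK⟩ := Metric.tendsto_atTop.mp ha (ε / 4) (by positivity)
    -- the finitely many terms below `K` tend to `0` termwise
    have hfin : Tendsto (fun i => ∑ n ∈ Finset.range K, t i n) l (𝓝 0) := by
      have h : Tendsto (fun i => ∑ n ∈ Finset.range K, t i n) l
          (𝓝 (∑ n ∈ Finset.range K, (1 - 1) * (s (n + 1) - T))) :=
        tendsto_finsetSum _ fun n _ => ((hw_one n).sub (hw_one (n + 1))).mul_const _
      simpa using h
    have hfin' : ∀ᶠ i in l, dist (∑ n ∈ Finset.range K, t i n) 0 < ε / 2 :=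
      Metric.tendsto_nhds.mp hfin (ε / 2) (by positivity)
    have hw0 : ∀ᶠ i in l, w i 0 < 2 :=
      (hw_one 0).eventually (eventually_lt_nhds (by norm_num : (1 : ℝ) < 2))
    filter_upwards [hfin', hw0, hw_anti, hw_nonneg, hw_zero] with i hi hi0 hanti hnonneg hzero
    -- extend the range to `R = max (N i) K` (the added terms vanish) and split at `K`
    set R : ℕ := max (N i) K with hR
    have hext : ∑ n ∈ Finset.range (N i), t i n = ∑ n ∈ Finset.range R, t i n := by
      refine Finset.sum_subset (Finset.range_mono (le_max_left _ _)) fun n _ hn' => ?_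
      have hNn : N i ≤ n := by simpa using hn'
      simp only [ht, hzero n hNn, hzero (n + 1) (hNn.trans (Nat.le_succ n)), sub_self, zero_mul]
    rw [hext, ← Finset.sum_range_add_sum_Ico _ (le_max_right (N i) K)]
    -- the tail: `|∑_{K ≤ n < R} t i n| ≤ (ε/4)(w i K − w i R) ≤ (ε/4) w i 0`
    have htail : |∑ n ∈ Finset.Ico K R, t i n| ≤ w i 0 * (ε / 4) := by
      calc |∑ n ∈ Finset.Ico K R, t i n| ≤ ∑ n ∈ Finset.Ico K R, |t i n| :=
            Finset.abs_sum_le_sum_abs _ _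
        _ ≤ ∑ n ∈ Finset.Ico K R, (w i n - w i (n + 1)) * (ε / 4) := by
            refine Finset.sum_le_sum fun n hn => ?_
            have hKn : K ≤ n := (Finset.mem_Ico.mp hn).1
            have hd : 0 ≤ w i n - w i (n + 1) := sub_nonneg.mpr (hanti (Nat.le_succ n))
            simp only [ht]
            rw [abs_mul, abs_of_nonneg hd]
            refine mul_le_mul_of_nonneg_left ?_ hd
            have h := hK (n + 1) (by omega)
            rw [Real.dist_eq] at h
            exact h.le
        _ = (w i K - w i R) * (ε / 4) := by
            rw [← Finset.sum_mul, sum_Ico_sub_succ (w i) (le_max_right _ _)]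
        _ ≤ w i 0 * (ε / 4) := by
            have h1 : w i K ≤ w i 0 := hanti (Nat.zero_le K)
            have h2 : 0 ≤ w i R := hnonneg R
            gcongr
            linarith
    rw [Real.dist_eq, sub_zero] at hi ⊢
    have h3 : w i 0 * (ε / 4) ≤ 2 * (ε / 4) := by gcongr
    calc |∑ n ∈ Finset.range K, t i n + ∑ n ∈ Finset.Ico K R, t i n|
        ≤ |∑ n ∈ Finset.range K, t i n| + |∑ n ∈ Finset.Ico K R, t i n| := abs_add_le _ _
      _ < ε / 2 + 2 * (ε / 4) := add_lt_add_of_lt_of_le hi (htail.trans h3)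
      _ = ε := by ring
  have h := h0.add hmain
  rw [add_zero] at h
  exact h.congr' habel

/-- `tsum` form of `tendsto_sum_mul_weight_of_tendsto`. [folklore] -/
theorem tendsto_tsum_mul_weight_of_tendsto {a : ℕ → ℝ} {T : ℝ}
    (ha : Tendsto (fun N : ℕ => ∑ n ∈ Finset.range N, a n) atTop (𝓝 T))
    {ι : Type*} {l : Filter ι} (w : ι → ℕ → ℝ) (N : ι → ℕ)
    (hw_anti : ∀ᶠ i in l, Antitone (w i)) (hw_nonneg : ∀ᶠ i in l, ∀ n, 0 ≤ w i n)
    (hw_zero : ∀ᶠ i in l, ∀ n, N i ≤ n → w i n = 0)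
    (hw_one : ∀ n, Tendsto (fun i => w i n) l (𝓝 1)) :
    Tendsto (fun i => ∑' n, a n * w i n) l (𝓝 T) := by
  refine (tendsto_sum_mul_weight_of_tendsto ha w N hw_anti hw_nonneg hw_zero hw_one).congr' ?_
  filter_upwards [hw_zero] with i hz
  exact (tsum_eq_sum (s := Finset.range (N i)) fun n hn => by
    rw [hz n (by simpa using hn), mul_zero]).symm

/-- **Logarithmic Riesz means of a convergent series** (the weights of the crux line): for
`w_M(n) = max (1 − log(κ_M n)/log M) 0` with `κ_M ≥ 1` eventually and `log κ_M / log M → 0` (e.g.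
`κ_M = (log M)^θ`), `∑_{n<M} a(n) w_M(n) → T` whenever `∑_{n<N} a(n) → T`. [folklore] -/
theorem tendsto_sum_mul_logRiesz_of_tendsto {a : ℕ → ℝ} {T : ℝ}
    (ha : Tendsto (fun N : ℕ => ∑ n ∈ Finset.range N, a n) atTop (𝓝 T))
    {κ : ℕ → ℝ} (hκ1 : ∀ᶠ M in atTop, 1 ≤ κ M)
    (hκ : Tendsto (fun M : ℕ => Real.log (κ M) / Real.log M) atTop (𝓝 0)) :
    Tendsto (fun M : ℕ => ∑ n ∈ Finset.range M,
      a n * max (1 - Real.log (κ M * n) / Real.log M) 0) atTop (𝓝 T) := by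
  refine tendsto_sum_mul_weight_of_tendsto ha
    (fun M n => max (1 - Real.log (κ M * n) / Real.log M) 0) (fun M => M) ?_ ?_ ?_ ?_
  · -- antitone, for `M` with `1 ≤ κ M`
    filter_upwards [hκ1] with M hM
    have hκ0 : 0 < κ M := by linarith
    refine antitone_nat_of_succ_le fun n => max_le_max ?_ le_rfl
    rcases Nat.eq_zero_or_pos n with rfl | hn
    · simp only [Nat.cast_zero, mul_zero, Real.log_zero, zero_div, sub_zero, zero_add, Nat.cast_one,
        mul_one]
      exact sub_le_self _ (div_nonneg (Real.log_nonneg hM) (Real.log_natCast_nonneg M))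
    · have hlog : Real.log (κ M * n) ≤ Real.log (κ M * ((n + 1 : ℕ) : ℝ)) :=
        Real.log_le_log (by positivity) (by push_cast; nlinarith)
      have := div_le_div_of_nonneg_right hlog (Real.log_natCast_nonneg M)
      linarith
  · exact Filter.Eventually.of_forall fun M n => le_max_right _ _
  · -- the weights vanish for `n ≥ M` once `M ≥ 2` and `κ M ≥ 1`
    filter_upwards [hκ1, eventually_ge_atTop 2] with M hM hM2 n hn
    have hM0 : 0 < Real.log M := Real.log_pos (by exact_mod_cast hM2)
    have hle : Real.log M ≤ Real.log (κ M * n) :=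
      Real.log_le_log (by positivity) (by
        calc (M : ℝ) ≤ n := by exact_mod_cast hn
          _ = 1 * n := (one_mul _).symm
          _ ≤ κ M * n := by gcongr)
    refine max_eq_right ?_
    rw [sub_nonpos, le_div_iff₀ hM0, one_mul]
    exact hle
  · -- pointwise convergence to `1`
    intro n
    rcases Nat.eq_zero_or_pos n with rfl | hn
    · simp
    · have h1 : Tendsto (fun M : ℕ => Real.log (κ M * n) / Real.log M) atTop (𝓝 0) := by
        have hA : Tendsto (fun M : ℕ => Real.log n / Real.log (M : ℝ)) atTop (𝓝 0) :=
          tendsto_const_nhds.div_atTop (Real.tendsto_log_atTop.comp tendsto_natCast_atTop_atTop)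
        have h := hκ.add hA
        rw [add_zero] at h
        refine h.congr' ?_
        filter_upwards [hκ1] with M hM
        rw [Real.log_mul (by linarith) (by exact_mod_cast hn.ne'), add_div]
      have h2 := ((tendsto_const_nhds (x := (1 : ℝ))).sub h1).max
        (tendsto_const_nhds (x := (0 : ℝ)))
      rw [sub_zero, max_eq_left zero_le_one] at h2
      exact h2

end TypeDesign

end Literature.NumberTheory.LFunctions
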